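import Literature.NumberTheory.Rogawski1990.TestFunctions
import Literature.NumberTheory.Automorphic.LocalUnitaryIntegralLevel
import Literature.NumberTheory.Automorphic.UnitaryGroupAdelicProduct
import HarnessLib

/-!
# Pure tensors on `U(H)(𝔸_{L⁺})` are continuous with compact support: `PureTensor.toCc`
# (the level away from a finite set of places is clopen; boxes over compact factors are compact)
(Borel–Jacquet, Corvallis (1979), §4.1; Rogawski (1990), §14.2 p. 233; Platonov–Rapinchuk (1994), §5.1)

Topic `NumberTheory/Automorphic`; namespace `Literature.NumberTheory.Automorphic.UnitaryGroup` (dot-notation extensions of the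
tree's `UnitaryGroup.PureTensor` of `Rogawski1990/TestFunctions`).  Two small definitions with bodies (`awayIntegralLevel`, a
subgroup; `PureTensor.toCc`, a `C_c` packaging) and proved theorems; no named fact, no `sorry`, no instance, no notation.

**Setting.** `E/F` number fields, `c : E ≃ₐ[F] E`, `J ∈ M_N(E)`; the adelic unitary group `U(J)(𝔸_F) = (adelicGroupData F E c N J).Adelic`
with its decomposition ★ `adelicProdEquiv : U(J)(𝔸_F) ≃ₜ* U(J)(E ⊗ ℝ) × U(J)(𝔸_{F,f})` (`archPart`, `finPart`), the restricted product ★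
`finAdelicEquiv : U(J)(𝔸_{F,f}) ≃ₜ* Πʳ_v [U(J)(F_v), U(J)(𝒪_v)]` (`evalPlace v`), the projections ★ `toLocal v : U(J)(𝔸_F) →* U(J)(F_v)`
(`«local» … v`) and the integral levels ★ `localIntegralLevel c N J v ≤ «local» … v` (`LocalUnitaryIntegralLevel`).  In the CM case
`F = L⁺`, `E = L`, `c` = complex conjugation all of this IS the tree's `UnitaryGroup.cmDatum L N H` (★ `adelicGroupData_eq_cmDatum`, `rfl`),
over which ★ `UnitaryGroup.PureTensor L N H` (factorizable test data `f = f_∞ ⊗ ⊗_v f_v`, [Rogawski1990, §14.2]) is typed.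

* §0 `isCompact_setOf_forall_mem_restrictedProduct` — in a restricted product `Πʳ_i [R_i, A_i]` (cofinite), a BOX `{x | ∀ i, x_i ∈ B_i}`
  with `B_i` compact and `B_i ⊆ A_i` for almost all `i` is compact (Tychonoff in the principal restricted product, Mathlib
  `RestrictedProduct.isEmbedding_coe_of_principal`, then `inclusion`).
* §1 `toLocal_archToAdelic` (`(g_∞, 1)_v = 1`), `localPiEquiv_evalPlace_finPart` (`g_v` is the `v`-component of `g_f`),
  `toLocal_mem_localIntegralLevel_iff` (`g_v ∈ U(J)(𝒪_v) ↔ (g_f)_v ∈ localInt v`).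
* §2 `awayIntegralLevel S = {g | ∀ v ∉ S, g_v ∈ U(J)(𝒪_v)}` — an OPEN, hence CLOPEN, subgroup of `U(J)(𝔸_F)` (Mathlib
  `RestrictedProduct.isOpen_forall_imp_mem`; [BorelJacquet1979, §4.1]: the groups `K^S = ∏_{v ∉ S} K_v` are open).
* §3 `isCompact_setOf_archPart_mem_forall_evalPlace_mem` — `{g | g_∞ ∈ C_∞, ∀ v, (g_f)_v ∈ C_v}` is compact for compact `C_∞`, `C_v`
  with `C_v ⊆ U(J)(𝒪_v)` off a finite set.
* §4 (CM, `PureTensor`) `PureTensor.eval_eq_indicator`; **`PureTensor.continuous_eval`** and **`PureTensor.hasCompactSupport_eval`** for a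
  pure tensor whose unramified levels ARE the integral levels off its bad set (`∀ v ∉ T.S, T.K v = cmLocalIntegralLevel L N H v` — the
  honesty clause `IsUnramifiedOutside` of `TestFunctions` ed. 2, taken here as an explicit hypothesis) and whose factors `f_∞`, `f_v`
  (`v ∈ S`) are continuous, resp. compactly supported; **`PureTensor.toCc`**: the pure tensor as an element of
  `C_c(U(H)(𝔸_{L⁺}), ℂ)` — the currency `TestGp = C_c` of the ENGINE T1 kit's `Transfer` (line `F0_T1InnerFormTraceIdentity`).

Written for the cell `hodgecm-mathlib` (ENGINE T1, brick B10-lite).  HC_CM is proved only modulo the printed citations until rung 0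
closes; this file is unconditional.

## References
* [BorelJacquet1979] A. Borel, H. Jacquet, *Automorphic forms and automorphic representations*, PSPM 33.1 (1979), §4.1
  (`G(𝔸) = G_∞ × G(𝔸_f)`, the compact open subgroups `K^S`, `C_c^∞(G(𝔸)) = ⊗′`).
* [Rogawski1990] J. Rogawski, Ann. of Math. Stud. 123 (1990), §14.2 p. 233 (`f = ⊗ f_v`, `f_v = 1_{K_v}` for almost all `v`).
* [PlatonovRapinchuk1994] V. Platonov, A. Rapinchuk, *Algebraic Groups and Number Theory* (1994), §5.1 (`G_{𝔸} = ∏′ (G_{F_v} : G_{𝒪_v})`).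
-/

set_option autoImplicit false

noncomputable section

open NumberField IsDedekindDomain Filter Set
open scoped RestrictedProduct

namespace Literature.NumberTheory.Automorphic

/-! ## §0 Boxes in a restricted product are compact -/

/-- **A box in a restricted product is compact**: for `B_i ⊆ R_i` compact with `B_i ⊆ A_i` for almost all `i`,
`{x ∈ Πʳ_i [R_i, A_i] | ∀ i, x_i ∈ B_i}` is compact (it is the image, under the continuous `inclusion` of the principal restricted
product over `S = {i | B_i ⊆ A_i}`, of the preimage of the Tychonoff-compact `∏ B_i` under the embedding into `∏ R_i`).
[cite: BorelJacquet1979, §4.1] -/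
theorem isCompact_setOf_forall_mem_restrictedProduct {ι : Type*} {R : ι → Type*} [∀ i, TopologicalSpace (R i)]
    {A : ∀ i, Set (R i)} {B : ∀ i, Set (R i)} (hB : ∀ i, IsCompact (B i)) (hBA : ∀ᶠ i in cofinite, B i ⊆ A i) :
    IsCompact {x : Πʳ i, [R i, A i] | ∀ i, x i ∈ B i} := by
  set S : Set ι := {i | B i ⊆ A i} with hS_def
  have hS : (cofinite : Filter ι) ≤ 𝓟 S := le_principal_iff.2 hBA
  have hQ : IsCompact (Set.univ.pi B : Set (Π i, R i)) := isCompact_univ_pi hB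
  have h1 : IsCompact (((↑) : Πʳ i, [R i, A i]_[𝓟 S] → Π i, R i) ⁻¹' Set.univ.pi B) := by
    refine (RestrictedProduct.isEmbedding_coe_of_principal.isCompact_preimage_iff ?_).2 hQ
    rw [RestrictedProduct.range_coe_principal]
    exact fun x hx i hi => hi (hx i (Set.mem_univ i))
  have h2 := h1.image (RestrictedProduct.continuous_inclusion hS)
  convert h2 using 1
  ext x
  constructor
  · intro hx
    have hx' : ∀ᶠ i in 𝓟 S, x i ∈ A i := Filter.eventually_principal.2 fun i hi => hi (hx i)
    obtain ⟨y, rfl⟩ := RestrictedProduct.exists_inclusion_eq_of_eventually R A hS hx'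
    exact ⟨y, fun i _ => hx i, rfl⟩
  · rintro ⟨y, hy, rfl⟩ i
    exact hy i (Set.mem_univ i)

namespace UnitaryGroup

section Generic

variable (F E : Type) [Field F] [NumberField F] [Field E] [NumberField E] [Algebra F E] (c : E ≃ₐ[F] E) (N : ℕ)
  (J : Matrix (Fin N) (Fin N) E)

/-! ## §1 Local components of the archimedean and finite parts -/

/-- **`(g_∞, 1)_v = 1`**: the archimedean factor has trivial image in every `U(J)(F_v)`. [cite: BorelJacquet1979, §4.1] -/
theorem toLocal_archToAdelic (v : HeightOneSpectrum (𝓞 F)) (a : arch F E c N J) :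
    toLocal E c N J v (archToAdelic F E c N J a : adelic F E c N J) = 1 := by
  refine Subtype.ext (Units.ext (Matrix.ext fun i j => funext fun w => ?_))
  change adeleToLocal E v (((GLn.ofInfinite N E (a : GL (Fin N) (mixedEmbedding.mixedSpace E)) :
      GL (Fin N) (AdeleRing (𝓞 E) E)) : Matrix (Fin N) (Fin N) (AdeleRing (𝓞 E) E)) i j) w =
    (1 : Matrix (Fin N) (Fin N) (LocalRing E v)) i j w
  rw [adeleToLocal_apply, GLn.coe_ofInfinite_apply, Matrix.one_apply, Matrix.one_apply]
  split_ifs <;> rfl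

/-- **`g_v` depends only on `g_f`**: `toLocal v g = toLocal v (1, g_f)`. [cite: BorelJacquet1979, §4.1] -/
theorem toLocal_eq_toLocal_finPart (v : HeightOneSpectrum (𝓞 F)) (g : (adelicGroupData F E c N J).Adelic) :
    toLocal E c N J v (g : adelic F E c N J) =
      toLocal E c N J v (finAdelicToAdelic F E c N J (finPart F E c N J g) : adelic F E c N J) := by
  -- entrywise: both sides read the finite components `(g_{ij})_w` of `g`
  refine Subtype.ext (Units.ext (Matrix.ext fun i j => funext fun w => ?_))
  change adeleToLocal E v (((adelicVal F E c N J g : GL (Fin N) (AdeleRing (𝓞 E) E)) :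
      Matrix (Fin N) (Fin N) (AdeleRing (𝓞 E) E)) i j) w =
    adeleToLocal E v (((GLn.ofFinite N E (GLn.sndHom N E (adelicVal F E c N J g)) : GL (Fin N) (AdeleRing (𝓞 E) E)) :
      Matrix (Fin N) (Fin N) (AdeleRing (𝓞 E) E)) i j) w
  rw [adeleToLocal_apply, adeleToLocal_apply, GLn.coe_ofFinite_apply]
  rfl

/-- **`g_v` is the `v`-component of `g_f`**: `localPiEquiv (evalPlace v g_f) = toLocal v g` (★ `localPiEquiv_evalPlace`).
[cite: PlatonovRapinchuk1994, §5.1] -/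
theorem localPiEquiv_evalPlace_finPart (v : HeightOneSpectrum (𝓞 F)) (g : (adelicGroupData F E c N J).Adelic) :
    localPiEquiv E c N J v (evalPlace F E c N J v (finPart F E c N J g)) = toLocal E c N J v (g : adelic F E c N J) := by
  rw [toLocal_eq_toLocal_finPart]
  exact Subtype.ext (localPiEquiv_evalPlace F E c N J v (finPart F E c N J g))

/-- **`g_v ∈ U(J)(𝒪_v) ↔ (g_f)_v ∈ localInt v`** (the integral level on `«local»` vs. on the restricted-product factor).
[cite: PlatonovRapinchuk1994, §5.1] -/
theorem toLocal_mem_localIntegralLevel_iff (v : HeightOneSpectrum (𝓞 F)) (g : (adelicGroupData F E c N J).Adelic) :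
    toLocal E c N J v (g : adelic F E c N J) ∈ localIntegralLevel c N J v ↔
      evalPlace F E c N J v (finPart F E c N J g) ∈ localInt E c N J v := by
  rw [← localPiEquiv_evalPlace_finPart, localPiEquiv_mem_localIntegralLevel_iff]

/-! ## §2 The level away from `S`: `K^S = {g | ∀ v ∉ S, g_v ∈ U(J)(𝒪_v)}` is a clopen subgroup -/

/-- **The integral level away from a finite set `S` of places**, `K^S := {g ∈ U(J)(𝔸_F) | ∀ v ∉ S, g_v ∈ U(J)(𝒪_v)}`
(no condition at `S` or at infinity). [cite: BorelJacquet1979, §4.1] -/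
def awayIntegralLevel (S : Finset (HeightOneSpectrum (𝓞 F))) : Subgroup (adelicGroupData F E c N J).Adelic :=
  ⨅ (v : HeightOneSpectrum (𝓞 F)) (_ : v ∉ S), (localIntegralLevel c N J v).comap (toLocal E c N J v)

/-- Membership in `K^S`: `∀ v ∉ S, g_v ∈ U(J)(𝒪_v)`. [cite: BorelJacquet1979, §4.1] -/
theorem mem_awayIntegralLevel_iff (S : Finset (HeightOneSpectrum (𝓞 F))) (g : (adelicGroupData F E c N J).Adelic) :
    g ∈ awayIntegralLevel F E c N J S ↔ ∀ v ∉ S, toLocal E c N J v (g : adelic F E c N J) ∈ localIntegralLevel c N J v := by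
  simp only [awayIntegralLevel, Subgroup.mem_iInf, Subgroup.mem_comap]
  rfl

/-- `K^S` read in the restricted product: the preimage of `{x | ∀ v ∉ S, x_v ∈ localInt v}` under `g ↦ finAdelicEquiv g_f`.
[cite: PlatonovRapinchuk1994, §5.1] -/
theorem coe_awayIntegralLevel (S : Finset (HeightOneSpectrum (𝓞 F))) :
    (awayIntegralLevel F E c N J S : Set (adelicGroupData F E c N J).Adelic) =
      (fun g => finAdelicEquiv F E c N J (finPart F E c N J g)) ⁻¹'
        {x : Πʳ v : HeightOneSpectrum (𝓞 F), [localPi E c N J v, localInt E c N J v] |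
          ∀ v, v ∉ S → x v ∈ (localInt E c N J v : Set (localPi E c N J v))} := by
  ext g
  simp only [SetLike.mem_coe, mem_awayIntegralLevel_iff, Set.mem_preimage, Set.mem_setOf_eq,
    toLocal_mem_localIntegralLevel_iff]
  rfl

/-- **`K^S` is OPEN** in `U(J)(𝔸_F)` (the defining property of the restricted-product topology: Mathlib
`RestrictedProduct.isOpen_forall_imp_mem`, each `U(J)(𝒪_v)` being open). [cite: BorelJacquet1979, §4.1] -/
theorem isOpen_awayIntegralLevel (S : Finset (HeightOneSpectrum (𝓞 F))) :
    IsOpen (awayIntegralLevel F E c N J S : Set (adelicGroupData F E c N J).Adelic) := by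
  rw [coe_awayIntegralLevel]
  exact (RestrictedProduct.isOpen_forall_imp_mem (fun v => isOpen_localInt E c N J v)).preimage
    ((finAdelicEquiv F E c N J).continuous.comp (continuous_finPart F E c N J))

/-- **`K^S` is CLOSED** (an open subgroup is closed), hence clopen. [cite: BorelJacquet1979, §4.1] -/
theorem isClopen_awayIntegralLevel (S : Finset (HeightOneSpectrum (𝓞 F))) :
    IsClopen (awayIntegralLevel F E c N J S : Set (adelicGroupData F E c N J).Adelic) :=
  ⟨Subgroup.isClosed_of_isOpen _ (isOpen_awayIntegralLevel F E c N J S), isOpen_awayIntegralLevel F E c N J S⟩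

/-! ## §3 Boxes `{g | g_∞ ∈ C_∞, ∀ v, (g_f)_v ∈ C_v}` are compact -/

/-- **Boxes are compact**: for compact `C_∞ ⊆ U(J)(E ⊗ ℝ)` and compact `C_v ⊆ U(J)(F_v)` with `C_v ⊆ U(J)(𝒪_v)` off a finite set
`S`, the set `{g ∈ U(J)(𝔸_F) | g_∞ ∈ C_∞ ∧ ∀ v, (g_f)_v ∈ C_v}` is compact (`adelicProdEquiv`, `finAdelicEquiv` and §0).
[cite: BorelJacquet1979, §4.1] -/
theorem isCompact_setOf_archPart_mem_forall_evalPlace_mem (S : Finset (HeightOneSpectrum (𝓞 F))) {C₀ : Set (arch F E c N J)}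
    (hC₀ : IsCompact C₀) {C : ∀ v : HeightOneSpectrum (𝓞 F), Set (localPi E c N J v)} (hC : ∀ v, IsCompact (C v))
    (hCS : ∀ v ∉ S, C v ⊆ localInt E c N J v) :
    IsCompact {g : (adelicGroupData F E c N J).Adelic |
      archPart F E c N J g ∈ C₀ ∧ ∀ v, evalPlace F E c N J v (finPart F E c N J g) ∈ C v} := by
  have hev : ∀ᶠ v in cofinite, C v ⊆ (localInt E c N J v : Set (localPi E c N J v)) := by
    refine Filter.eventually_cofinite.2 (S.finite_toSet.subset fun v hv => ?_)
    by_contra hvS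
    exact hv (hCS v hvS)
  have hbox : IsCompact {x : Πʳ v : HeightOneSpectrum (𝓞 F), [localPi E c N J v, localInt E c N J v] | ∀ v, x v ∈ C v} :=
    isCompact_setOf_forall_mem_restrictedProduct hC hev
  have h2 : IsCompact (C₀ ×ˢ ((finAdelicEquiv F E c N J).symm ''
      {x : Πʳ v : HeightOneSpectrum (𝓞 F), [localPi E c N J v, localInt E c N J v] | ∀ v, x v ∈ C v})) :=
    hC₀.prod (hbox.image (finAdelicEquiv F E c N J).symm.continuous)
  have h3 := h2.image (adelicProdEquiv F E c N J).symm.continuous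
  convert h3 using 1
  ext g
  constructor
  · rintro ⟨h₀, hf⟩
    refine ⟨(archPart F E c N J g, finPart F E c N J g), ⟨h₀, finAdelicEquiv F E c N J (finPart F E c N J g), hf,
      (finAdelicEquiv F E c N J).symm_apply_apply _⟩, ?_⟩
    exact (adelicProdEquiv F E c N J).symm_apply_apply g
  · rintro ⟨⟨a, b⟩, ⟨ha, x, hx, hxb⟩, rfl⟩
    have h := (adelicProdEquiv F E c N J).apply_symm_apply (a, b)
    rw [adelicProdEquiv_apply, Prod.mk.injEq] at h
    refine ⟨?_, fun v => ?_⟩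
    · change archPart F E c N J ((adelicProdEquiv F E c N J).symm (a, b)) ∈ C₀
      rw [h.1]
      exact ha
    · change finAdelicEquiv F E c N J (finPart F E c N J ((adelicProdEquiv F E c N J).symm (a, b))) v ∈ C v
      have hxb' : (finAdelicEquiv F E c N J).symm x = b := hxb
      rw [h.2, ← hxb', (finAdelicEquiv F E c N J).apply_symm_apply]
      exact hx v

end Generic

/-! ## §4 Pure tensors on `U(H)(𝔸_{L⁺})` (CM): continuity, compact support, `toCc` -/

section CM

variable {L : Type} [Field L] [NumberField L] [IsCMField L] {N : ℕ} {H : Matrix (Fin N) (Fin N) L}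

namespace PureTensor

/-- `eval` is the indicator of the unramified set `{g | ∀ v ∉ S, g_v ∈ K_v}` times `g ↦ f_∞(g_∞) · ∏_{v ∈ S} f_v(g_v)`.
[cite: Rogawski1990, §14.2 p. 233] -/
theorem eval_eq_indicator (T : PureTensor L N H) :
    T.eval = Set.indicator {g : (cmDatum L N H).Adelic | ∀ v ∉ T.S, (cmDatum L N H).toLocal v g ∈ T.K v}
      (fun g => T.arch (archPart (↥(maximalRealSubfield L)) L (IsCMField.complexConj L) N H g) *
        ∏ v ∈ T.S, T.loc v ((cmDatum L N H).toLocal v g)) := by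
  funext g
  by_cases h : ∀ v ∉ T.S, (cmDatum L N H).toLocal v g ∈ T.K v
  · have hmem : g ∈ {g : (cmDatum L N H).Adelic | ∀ v ∉ T.S, (cmDatum L N H).toLocal v g ∈ T.K v} := h
    rw [eval_eq_of_forall_mem T g h, Set.indicator_of_mem hmem]
  · have hmem : g ∉ {g : (cmDatum L N H).Adelic | ∀ v ∉ T.S, (cmDatum L N H).toLocal v g ∈ T.K v} := h
    rw [Set.indicator_of_notMem hmem, eval, if_neg h]

/-- The unramified set of a pure tensor whose levels are the integral levels off `S` IS the clopen subgroup `K^S`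
(`awayIntegralLevel`). [cite: BorelJacquet1979, §4.1] -/
theorem setOf_forall_mem_eq_awayIntegralLevel (T : PureTensor L N H)
    (hK : ∀ v ∉ T.S, T.K v = cmLocalIntegralLevel L N H v) :
    {g : (cmDatum L N H).Adelic | ∀ v ∉ T.S, (cmDatum L N H).toLocal v g ∈ T.K v} =
      ((awayIntegralLevel (↥(maximalRealSubfield L)) L (IsCMField.complexConj L) N H T.S :
          Subgroup (adelicGroupData (↥(maximalRealSubfield L)) L (IsCMField.complexConj L) N H).Adelic) :
        Set (adelicGroupData (↥(maximalRealSubfield L)) L (IsCMField.complexConj L) N H).Adelic) := by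
  ext g
  change (∀ v ∉ T.S, (cmDatum L N H).toLocal v g ∈ T.K v) ↔
    g ∈ awayIntegralLevel (↥(maximalRealSubfield L)) L (IsCMField.complexConj L) N H T.S
  refine Iff.trans ?_
    (mem_awayIntegralLevel_iff (↥(maximalRealSubfield L)) L (IsCMField.complexConj L) N H T.S g).symm
  refine forall₂_congr fun v hv => ?_
  rw [hK v hv]
  rfl

/-- The unramified set of such a pure tensor is clopen. [cite: BorelJacquet1979, §4.1] -/
theorem isClopen_setOf_forall_mem (T : PureTensor L N H) (hK : ∀ v ∉ T.S, T.K v = cmLocalIntegralLevel L N H v) :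
    IsClopen {g : (cmDatum L N H).Adelic | ∀ v ∉ T.S, (cmDatum L N H).toLocal v g ∈ T.K v} := by
  rw [setOf_forall_mem_eq_awayIntegralLevel T hK]
  exact isClopen_awayIntegralLevel (↥(maximalRealSubfield L)) L (IsCMField.complexConj L) N H T.S

/-- **A pure tensor with integral levels off `S`, continuous archimedean factor and continuous factors at `S` is CONTINUOUS**
on `U(H)(𝔸_{L⁺})` (indicator of the clopen `K^S` times a finite product of continuous functions of the components).
[cite: BorelJacquet1979, §4.1] -/
theorem continuous_eval (T : PureTensor L N H) (hK : ∀ v ∉ T.S, T.K v = cmLocalIntegralLevel L N H v)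
    (harch : Continuous T.arch) (hloc : ∀ v ∈ T.S, Continuous (T.loc v)) : Continuous T.eval := by
  have hcl := isClopen_setOf_forall_mem T hK
  rw [eval_eq_indicator]
  refine Continuous.indicator (fun a ha => ?_) ?_
  · rw [hcl.frontier_eq] at ha
    exact absurd ha (Set.notMem_empty a)
  · exact (harch.comp (continuous_archPart (↥(maximalRealSubfield L)) L (IsCMField.complexConj L) N H)).mul
      (continuous_finsetProd T.S fun v hv => (hloc v hv).comp ((cmDatum L N H).continuous_toLocal v))

/-- **… and it has COMPACT SUPPORT** when the archimedean factor and the factors at `S` have compact support: the support lies in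
the compact box `{g | g_∞ ∈ tsupport f_∞, g_v ∈ tsupport f_v (v ∈ S), g_v ∈ U(H)(𝒪_v) (v ∉ S)}` (§3).
[cite: BorelJacquet1979, §4.1] -/
theorem hasCompactSupport_eval (T : PureTensor L N H) (hK : ∀ v ∉ T.S, T.K v = cmLocalIntegralLevel L N H v)
    (harch : HasCompactSupport T.arch) (hloc : ∀ v ∈ T.S, HasCompactSupport (T.loc v)) : HasCompactSupport T.eval := by
  classical
  -- the compact box
  let C : ∀ v : HeightOneSpectrum (𝓞 ↥(maximalRealSubfield L)),
      Set (localPi L (IsCMField.complexConj L) N H v) := fun v =>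
    if v ∈ T.S then (localPiEquiv L (IsCMField.complexConj L) N H v).symm '' tsupport (T.loc v)
    else (localInt L (IsCMField.complexConj L) N H v : Set (localPi L (IsCMField.complexConj L) N H v))
  have hC : ∀ v, IsCompact (C v) := by
    intro v
    by_cases hv : v ∈ T.S
    · simp only [C, if_pos hv]
      exact (hloc v hv).isCompact.image (localPiEquiv L (IsCMField.complexConj L) N H v).symm.continuous
    · simp only [C, if_neg hv]
      exact isCompact_localInt L (IsCMField.complexConj L) N H v
  have hCS : ∀ v ∉ T.S, C v ⊆ localInt L (IsCMField.complexConj L) N H v := by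
    intro v hv
    simp only [C, if_neg hv]
    exact subset_rfl
  refine HasCompactSupport.intro
    (isCompact_setOf_archPart_mem_forall_evalPlace_mem (↥(maximalRealSubfield L)) L (IsCMField.complexConj L) N H T.S
      harch.isCompact hC hCS) fun g hg => ?_
  -- off the box, `eval g = 0`
  have hg' : ¬ (archPart (↥(maximalRealSubfield L)) L (IsCMField.complexConj L) N H g ∈ tsupport T.arch ∧
      ∀ v, evalPlace (↥(maximalRealSubfield L)) L (IsCMField.complexConj L) N H v
        (finPart (↥(maximalRealSubfield L)) L (IsCMField.complexConj L) N H g) ∈ C v) := hg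
  rcases not_and_or.1 hg' with h₀ | h₁
  · -- `g_∞ ∉ tsupport f_∞`
    rw [eval_eq_indicator]
    by_cases hmem : g ∈ {g : (cmDatum L N H).Adelic | ∀ v ∉ T.S, (cmDatum L N H).toLocal v g ∈ T.K v}
    · rw [Set.indicator_of_mem hmem, image_eq_zero_of_notMem_tsupport h₀, zero_mul]
    · rw [Set.indicator_of_notMem hmem]
  · obtain ⟨v, hv⟩ := not_forall.1 h₁
    by_cases hvS : v ∈ T.S
    · -- `g_v ∉ tsupport f_v` for some `v ∈ S`
      have hv' : (cmDatum L N H).toLocal v g ∉ tsupport (T.loc v) := by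
        intro h
        apply hv
        simp only [C, if_pos hvS]
        refine ⟨(cmDatum L N H).toLocal v g, h, ?_⟩
        calc (localPiEquiv L (IsCMField.complexConj L) N H v).symm ((cmDatum L N H).toLocal v g)
            = (localPiEquiv L (IsCMField.complexConj L) N H v).symm
                (localPiEquiv L (IsCMField.complexConj L) N H v
                  (evalPlace (↥(maximalRealSubfield L)) L (IsCMField.complexConj L) N H v
                    (finPart (↥(maximalRealSubfield L)) L (IsCMField.complexConj L) N H g))) := by
              rw [localPiEquiv_evalPlace_finPart]; rfl
          _ = evalPlace (↥(maximalRealSubfield L)) L (IsCMField.complexConj L) N H v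
                (finPart (↥(maximalRealSubfield L)) L (IsCMField.complexConj L) N H g) :=
              (localPiEquiv L (IsCMField.complexConj L) N H v).symm_apply_apply _
      have h0 : T.loc v ((cmDatum L N H).toLocal v g) = 0 := image_eq_zero_of_notMem_tsupport hv'
      rw [eval_eq_indicator]
      by_cases hmem : g ∈ {g : (cmDatum L N H).Adelic | ∀ v ∉ T.S, (cmDatum L N H).toLocal v g ∈ T.K v}
      · rw [Set.indicator_of_mem hmem, Finset.prod_eq_zero hvS h0, mul_zero]
      · rw [Set.indicator_of_notMem hmem]
    · -- `g_v ∉ U(H)(𝒪_v)` for some `v ∉ S`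
      have hv' : (cmDatum L N H).toLocal v g ∉ T.K v := by
        rw [hK v hvS]
        intro h
        apply hv
        simp only [C, if_neg hvS]
        exact (toLocal_mem_localIntegralLevel_iff (↥(maximalRealSubfield L)) L (IsCMField.complexConj L) N H v g).1 h
      exact eval_eq_zero_of_not_mem T g hvS hv'

/-- **`PureTensor.toCc`: a pure tensor as an element of `C_c(U(H)(𝔸_{L⁺}), ℂ)`** (integral levels off `S`; continuous compactly
supported factors at `S` and at infinity) — the currency `TestGp = C_c((cmDatum L 3 H).Adelic, ℂ)` in which the ENGINE T1 kit's
`Transfer` takes its arguments. [cite: Rogawski1990, §14.2 p. 233] -/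
def toCc (T : PureTensor L N H) (hK : ∀ v ∉ T.S, T.K v = cmLocalIntegralLevel L N H v)
    (harch : Continuous T.arch) (harch' : HasCompactSupport T.arch)
    (hloc : ∀ v ∈ T.S, Continuous (T.loc v)) (hloc' : ∀ v ∈ T.S, HasCompactSupport (T.loc v)) :
    CompactlySupportedContinuousMap (cmDatum L N H).Adelic ℂ :=
  ⟨⟨T.eval, T.continuous_eval hK harch hloc⟩, T.hasCompactSupport_eval hK harch' hloc'⟩

/-- `toCc T … g = T.eval g`. [cite: Rogawski1990, §14.2 p. 233] -/
@[simp] theorem toCc_apply (T : PureTensor L N H) (hK : ∀ v ∉ T.S, T.K v = cmLocalIntegralLevel L N H v)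
    (harch : Continuous T.arch) (harch' : HasCompactSupport T.arch)
    (hloc : ∀ v ∈ T.S, Continuous (T.loc v)) (hloc' : ∀ v ∈ T.S, HasCompactSupport (T.loc v))
    (g : (cmDatum L N H).Adelic) :
    T.toCc hK harch harch' hloc hloc' g = T.eval g := rfl

end PureTensor

end CM

end UnitaryGroup

end Literature.NumberTheory.Automorphic

end
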